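import Summits.Ventures.PercRepro.S1TriangleUnionSix
import Summits.Ventures.PercRepro.S1ChainCellTenSevenCond

/-!
# PercRepro — THE CELL `(10, 7)` MODULO TWO SMALL CAPS (p2, gen 25; SUBCLAIM-S1 §6.9 (x))

The joint cap of `c025_core_ten_seven_of_joint_cap` («a coloop-free `e`-free core of rank `10` on `17` points with
`≥ 9` triangles has `≤ 32` four-circuits») reduced to two statements about SMALL matroids. On such a core the union
`S₀` of the triangles has nullity `6` (S1TriangleUnionSix), every four-circuit lies inside `S₀` or contains
`X := E ∖ S₀`, `s₃ ≤ 10`, and the triangle lever bounds `|S₀|`: at `s₃ = 10` every point of `S₀` lies on `≥ 3`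
triangles and `|S₀| ≤ 10`, so `|X| ≥ 7` and no four-circuit contains `X`; at `s₃ = 9` every point lies on `≥ 2`
triangles and `|S₀| ≤ 13`, so `|X| ≥ 4` and the only four-circuit that can contain `X` is `X` itself. Hence the
four-circuits of the core number at most those of the restriction `N ↾ S₀` (an `e`-free matroid of nullity `6`
with all the triangles) plus one, and the two caps

* (P10) `ν = 6`, `≤ 10` points, `10` triangles, every point on `≥ 3` of them ⇒ `s₄ ≤ 32`,
* (P9) `ν = 6`, `≤ 13` points, `9` triangles, every point on `≥ 2` of them ⇒ `s₄ ≤ 31`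

close the cell: **`c025_core_ten_seven_of_small_caps`**. (Paper, §6.9 (x): (P10) holds with `15` — the restriction is
a `10`-point rank-`4` matroid and each point lies on `≤ 6` four-circuits; (P9) is the open part.)
Axioms: standard.
-/

open scoped Matroid

namespace PercRepro

namespace S1

open Set

variable {α : Type}

/-- **THE CELL `(10, 7)` MODULO TWO SMALL CAPS**: `RLS` at `(10, 4)` on every `e`-free core of rank `10` with `17`
points, provided (P10) every `e`-free matroid of nullity `6` with `≤ 10` points, `10` triangles and every point on
`≥ 3` triangles has `≤ 32` four-circuits, and (P9) every `e`-free matroid of nullity `6` with `≤ 13` points, `9`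
triangles and every point on `≥ 2` triangles has `≤ 31` four-circuits. -/
theorem c025_core_ten_seven_of_small_caps (M : Matroid α) [M.Finite] (hR : M.eRank = (10 : ℕ))
    (hn : M.E.ncard = 17)
    (hfree : ∀ e ∈ M.E, ∃ A ⊆ M.E \ {e}, e ∉ M.closure A ∧ e ∉ M.closure ((M.E \ {e}) \ A))
    (hP10 : ∀ (N : Matroid α) [N.Finite],
      (∀ e ∈ N.E, ∃ A ⊆ N.E \ {e}, e ∉ N.closure A ∧ e ∉ N.closure ((N.E \ {e}) \ A)) →
      N.E.encard = N.eRank + ((6 : ℕ) : ℕ∞) → N.E.ncard ≤ 10 →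
      {C : Set α | N.IsCircuit C ∧ C.ncard = 3}.ncard = 10 →
      (∀ x ∈ N.E, 3 ≤ {C : Set α | N.IsCircuit C ∧ C.ncard = 3 ∧ x ∈ C}.ncard) →
      {C : Set α | N.IsCircuit C ∧ C.ncard = 4}.ncard ≤ 32)
    (hP9 : ∀ (N : Matroid α) [N.Finite],
      (∀ e ∈ N.E, ∃ A ⊆ N.E \ {e}, e ∉ N.closure A ∧ e ∉ N.closure ((N.E \ {e}) \ A)) →
      N.E.encard = N.eRank + ((6 : ℕ) : ℕ∞) → N.E.ncard ≤ 13 →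
      {C : Set α | N.IsCircuit C ∧ C.ncard = 3}.ncard = 9 →
      (∀ x ∈ N.E, 2 ≤ {C : Set α | N.IsCircuit C ∧ C.ncard = 3 ∧ x ∈ C}.ncard) →
      {C : Set α | N.IsCircuit C ∧ C.ncard = 4}.ncard ≤ 31) :
    ThmN.RLS M 10 4 := by
  refine c025_core_ten_seven_of_joint_cap M hR hn hfree ?_
  intro N _ hNfree hNd hNn hNcol h9
  obtain ⟨S, hSE, -, hcov, hsub, hν, hfour⟩ := exists_triangle_union N hNfree hNd hNn hNcol h9
  obtain ⟨h10, hs10, hs9, hdeg⟩ := triangle_union_bounds N hNfree hNn hSE hcov hsub hν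
  have hEfin : N.E.Finite := N.ground_finite
  have hSfin : S.Finite := hEfin.subset hSE
  -- the restriction `N ↾ S`
  haveI : (N ↾ S).Finite := N.restrict_finite hSfin
  have hfree' := hfree_restrict N hNfree hSE
  have hd' : (N ↾ S).E.encard = (N ↾ S).eRank + ((6 : ℕ) : ℕ∞) := by
    rw [Matroid.restrict_ground_eq, Matroid.eRank_restrict]; exact hν
  have hn' : (N ↾ S).E.ncard = S.ncard := by rw [Matroid.restrict_ground_eq]
  have htri' : {C : Set α | (N ↾ S).IsCircuit C ∧ C.ncard = 3} = {C : Set α | N.IsCircuit C ∧ C.ncard = 3} := by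
    ext C
    simp only [Set.mem_setOf_eq, Matroid.restrict_isCircuit_iff hSE]
    constructor
    · rintro ⟨⟨hC, -⟩, h3⟩; exact ⟨hC, h3⟩
    · rintro ⟨hC, h3⟩; exact ⟨⟨hC, hsub C hC h3⟩, h3⟩
  have hdeg' : ∀ x, {C : Set α | (N ↾ S).IsCircuit C ∧ C.ncard = 3 ∧ x ∈ C} =
      {C : Set α | N.IsCircuit C ∧ C.ncard = 3 ∧ x ∈ C} := by
    intro x
    ext C
    simp only [Set.mem_setOf_eq, Matroid.restrict_isCircuit_iff hSE]
    constructor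
    · rintro ⟨⟨hC, -⟩, h3, hx⟩; exact ⟨hC, h3, hx⟩
    · rintro ⟨hC, h3, hx⟩; exact ⟨⟨hC, hsub C hC h3⟩, h3, hx⟩
  have hfour' : {C : Set α | (N ↾ S).IsCircuit C ∧ C.ncard = 4} =
      {C : Set α | N.IsCircuit C ∧ C.ncard = 4 ∧ C ⊆ S} := by
    ext C
    simp only [Set.mem_setOf_eq, Matroid.restrict_isCircuit_iff hSE]
    tauto
  have hdegS : ∀ x ∈ (N ↾ S).E, {C : Set α | N.IsCircuit C ∧ C.ncard = 3}.ncard ≤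
      {C : Set α | (N ↾ S).IsCircuit C ∧ C.ncard = 3 ∧ x ∈ C}.ncard + 7 := by
    intro x hx
    rw [Matroid.restrict_ground_eq] at hx
    rw [hdeg']
    exact hdeg x hx
  -- the four-circuits of `N`: inside `S`, or containing `X = E ∖ S`
  have hAfin : {C : Set α | N.IsCircuit C ∧ C.ncard = 4 ∧ C ⊆ S}.Finite :=
    (finite_fourCircuits N).subset (fun C hC => ⟨hC.1, hC.2.1⟩)
  have hBfin : {C : Set α | N.IsCircuit C ∧ C.ncard = 4 ∧ ¬ C ⊆ S}.Finite :=
    (finite_fourCircuits N).subset (fun C hC => ⟨hC.1, hC.2.1⟩)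
  have hsplit : {C : Set α | N.IsCircuit C ∧ C.ncard = 4} =
      {C : Set α | N.IsCircuit C ∧ C.ncard = 4 ∧ C ⊆ S} ∪ {C : Set α | N.IsCircuit C ∧ C.ncard = 4 ∧ ¬ C ⊆ S} := by
    ext C
    simp only [Set.mem_setOf_eq, Set.mem_union]
    tauto
  have hdisj : Disjoint {C : Set α | N.IsCircuit C ∧ C.ncard = 4 ∧ C ⊆ S}
      {C : Set α | N.IsCircuit C ∧ C.ncard = 4 ∧ ¬ C ⊆ S} := by
    rw [Set.disjoint_left]
    rintro C ⟨-, -, h⟩ ⟨-, -, h'⟩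
    exact h' h
  have hout : ∀ C, N.IsCircuit C → C.ncard = 4 → ¬ C ⊆ S → N.E \ S ⊆ C :=
    fun C hC h4 hCS => (hfour C hC h4).resolve_left hCS
  have hXcard : (N.E \ S).ncard = 17 - S.ncard := by
    rw [Set.ncard_sdiff hSE hSfin, hNn]
  rw [hsplit, Set.ncard_union_eq hdisj hAfin hBfin]
  rcases (show {C : Set α | N.IsCircuit C ∧ C.ncard = 3}.ncard = 9 ∨
      {C : Set α | N.IsCircuit C ∧ C.ncard = 3}.ncard = 10 by omega) with hs | hs
  · -- `s₃ = 9`: `|S| ≤ 13`, so `|X| ≥ 4` and the outside four-circuits number at most one (`X` itself)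
    have hS13 := hs9 hs
    have houtle : {C : Set α | N.IsCircuit C ∧ C.ncard = 4 ∧ ¬ C ⊆ S}.ncard ≤ 1 := by
      refine (Set.ncard_le_ncard (t := {N.E \ S}) ?_ (Set.finite_singleton _)).trans (by simp)
      rintro C ⟨hC, h4, hCS⟩
      have hXC := hout C hC h4 hCS
      have hCfin : C.Finite := hEfin.subset hC.subset_ground
      have hXge : 4 ≤ (N.E \ S).ncard := by omega
      have heq : N.E \ S = C := Set.eq_of_subset_of_ncard_le hXC (by omega) hCfin
      rw [Set.mem_singleton_iff, heq]
    have hin := hP9 (N ↾ S) hfree' hd' (by rw [hn']; exact hS13) (by rw [htri']; exact hs)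
      (fun x hx => by have := hdegS x hx; omega)
    rw [hfour'] at hin
    omega
  · -- `s₃ = 10`: `|S| ≤ 10`, so `|X| ≥ 7` and no four-circuit contains `X`
    have hS10 := hs10 hs
    have houteq : {C : Set α | N.IsCircuit C ∧ C.ncard = 4 ∧ ¬ C ⊆ S}.ncard = 0 := by
      rw [Set.ncard_eq_zero hBfin, Set.eq_empty_iff_forall_notMem]
      rintro C ⟨hC, h4, hCS⟩
      have hXC := hout C hC h4 hCS
      have hCfin : C.Finite := hEfin.subset hC.subset_ground
      have := Set.ncard_le_ncard hXC hCfin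
      omega
    have hin := hP10 (N ↾ S) hfree' hd' (by rw [hn']; exact hS10) (by rw [htri']; exact hs)
      (fun x hx => by have := hdegS x hx; omega)
    rw [hfour'] at hin
    omega

end S1

end PercRepro
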